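import Summits.HubbardSuperconductivity.HubbardSuperconductivity.Theorems.WidthHaldaneTubeKinematics

/-!
# Transport of the column `d_{x²-y²}` pair field and of the Haldane law to the canonical carrier

Support file for the cruxes stated over `WidthHaldaneDefs` (routes `WidthHaldane`, `SeamInduction`;
items stmt-HubbardSuperconductivity-16311/16312/18509/18510); companion of
`WidthHaldaneTubeKinematics` (which transports the sector energies). Here the remaining objects of
`WidthHaldaneBridge` are transported along the signed-permutation relabelling `Γ_f`, `f = e'⁻¹ ∘ e`,
between any two labellings of one tube: the pair annihilator (`relabel_tubeDWavePair`), the column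
pair field (`relabel_columnPair`), the column pair correlation `G_ψ(r)`
(`tubeColumnPairCorr_relabelVec`), norms and sector ground states
(`isGroundStateInSector_tubeH0_relabelVec`). Consequence: `haldaneLawAt_iff_canonical` — the
per-width Haldane law `HaldaneLawAt` (the conclusion of the Bridge at one width, the skeletons'
`LawAt`) holds iff it holds on the canonical carrier `Fin (L·M)`; together with
`uniformThermo_iff_canonical` (`WidthHaldaneTubeBlochBound`) every "`∀ labellings`" clause of the
four items is free. Everything is PROVED; no definitions, no named facts.

Reference: O. Bratteli, D. W. Robinson, *Operator Algebras and Quantum Statistical Mechanics II*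
(1997) §5.2.2, Thm. 5.2.5 (one-particle bijections are unitarily implemented on Fock space).
-/

noncomputable section

namespace Summit.HubbardSuperconductivity.HubbardSuperconductivity.Theorems.WidthHaldane

set_option linter.dupNamespace false -- summit = problem name (single-conjunct summit), D-0017

open scoped BigOperators Classical Matrix ComplexConjugate
open Matrix Literature.MathematicalPhysics.QuantumLattice

section PairTransport

variable (L M : ℕ) [NeZero L] [NeZero M] (Λ : Type) [LinearOrder Λ] [Fintype Λ]
  (e : Λ ≃ ZMod L × ZMod M) (Λ' : Type) [LinearOrder Λ'] [Fintype Λ'] (e' : Λ' ≃ ZMod L × ZMod M)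

omit [NeZero L] [NeZero M] [LinearOrder Λ] [Fintype Λ] [LinearOrder Λ'] [Fintype Λ'] in
/-- The site bijection `e'⁻¹ ∘ e` maps `e⁻¹ p` to `e'⁻¹ p`. [folklore] -/
theorem trans_symm_apply_symm (p : ZMod L × ZMod M) : (e.trans e'.symm) (e.symm p) = e'.symm p := by
  simp

omit [NeZero L] [NeZero M] in
/-- **The `d_{x²-y²}` pair annihilator is covariant under relabelling**:
`Γ_f P_x(e) Γ_f⁻¹ = P_{f x}(e')`, `f = e'⁻¹ ∘ e`. [folklore] -/
theorem relabel_tubeDWavePair (x : Λ) :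
    relabel (Orb.mapEquiv (e.trans e'.symm)) (tubeDWavePair L M Λ e x) =
      tubeDWavePair L M Λ' e' ((e.trans e'.symm) x) := by
  unfold tubeDWavePair
  rw [map_sum]
  refine Finset.sum_congr rfl fun j _ => ?_
  rw [map_smul, map_sub, map_mul, map_mul, relabel_annihilation, relabel_annihilation,
    relabel_annihilation, relabel_annihilation, Orb.mapEquiv_orb, Orb.mapEquiv_orb, Orb.mapEquiv_orb,
    Orb.mapEquiv_orb, apply_trans_symm_apply]
  fin_cases j <;> simp

omit [NeZero L] in
/-- The column pair field `Φ_a = Σ_b P_{e⁻¹(a,b)}` is covariant under relabelling. [folklore] -/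
theorem relabel_columnPair (a : ZMod L) :
    relabel (Orb.mapEquiv (e.trans e'.symm)) (∑ b : ZMod M, tubeDWavePair L M Λ e (e.symm (a, b))) =
      ∑ b : ZMod M, tubeDWavePair L M Λ' e' (e'.symm (a, b)) := by
  rw [map_sum]
  refine Finset.sum_congr rfl fun b _ => ?_
  rw [relabel_tubeDWavePair, trans_symm_apply_symm]

/-- **The column pair correlation is invariant under relabelling**: transporting the state by the
signed permutation `Γ_f` and the labelling from `e` to `e'` leaves `G_ψ(r)` unchanged.
[cite: BratteliRobinsonII1997, §5.2.2, Thm. 5.2.5] -/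
theorem tubeColumnPairCorr_relabelVec (ψ : Fock (Orb Λ)) (r : ZMod L) :
    tubeColumnPairCorr L M Λ' e' (relabelVec (Orb.mapEquiv (e.trans e'.symm)) ψ) r =
      tubeColumnPairCorr L M Λ e ψ r := by
  unfold tubeColumnPairCorr
  refine Finset.sum_congr rfl fun a _ => ?_
  rw [← relabel_columnPair L M Λ e Λ' e' a, ← relabel_columnPair L M Λ e Λ' e' (a + r),
    ← relabel_conjTranspose, ← map_mul, expect_relabel_relabelVec]

omit [NeZero L] [NeZero M] in
/-- Transported states keep their norm. [folklore] -/
theorem star_relabelVec_self (ψ : Fock (Orb Λ)) :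
    star (relabelVec (Orb.mapEquiv (e.trans e'.symm)) ψ) ⬝ᵥ relabelVec (Orb.mapEquiv (e.trans e'.symm)) ψ =
      star ψ ⬝ᵥ ψ :=
  star_relabelVec_dotProduct _ ψ ψ

omit [NeZero L] [NeZero M] in
/-- **Sector ground states of the pure tube are transported** from the labelling `e` to the
labelling `e'`. [cite: BratteliRobinsonII1997, §5.2.2, Thm. 5.2.5] -/
theorem isGroundStateInSector_tubeH0_relabelVec (U : ℝ) {N : ℕ} {ψ : Fock (Orb Λ)}
    (hψ : IsGroundStateInSector (tubeH0 L M Λ e U) N 0 ψ) :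
    IsGroundStateInSector (tubeH0 L M Λ' e' U) N 0 (relabelVec (Orb.mapEquiv (e.trans e'.symm)) ψ) := by
  rw [← relabel_tubeH0 L M Λ e Λ' e' U]
  exact hψ.relabelVec _

end PairTransport

section CanonicalLaw

variable (M : ℕ) [NeZero M]

/-- **Canonical-carrier reduction of the per-width Haldane law**: `HaldaneLawAt U δ M Ξ A R L₁` holds
iff it holds for the canonical carrier `Fin (L·M)` labelled by `finProdFinEquiv` and `ZMod.finEquiv`
— ground states, norms, the two responses and the column pair correlation are all transported by
the signed-permutation relabelling, so provers and refuters of the Bridge may fix the carrier.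
[folklore] -/
theorem haldaneLawAt_iff_canonical (U δ : ℝ) (Ξ A : ℝ) (R L₁ : ℕ) :
    HaldaneLawAt U δ M Ξ A R L₁ ↔
      ∀ (L : ℕ) [NeZero L], Even L → M ≤ L → L₁ ≤ L →
        ∀ ψ : Fock (Orb (Fin (L * M))), star ψ ⬝ᵥ ψ = 1 →
          IsGroundStateInSector (tubeH0 L M (Fin (L * M))
            (finProdFinEquiv.symm.trans
              (Equiv.prodCongr (ZMod.finEquiv L).toEquiv (ZMod.finEquiv M).toEquiv)) U)
            (tubeFilling L M δ) 0 ψ →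
          ∀ r : ZMod L, R ≤ r.val → r.val + R ≤ L →
            A * (L : ℝ) * (M : ℝ) ^ 2 * ((min r.val (L - r.val) : ℕ) : ℝ) ^
              (-(Ξ * Real.sqrt (tubePairCompressibility L M (Fin (L * M))
                (finProdFinEquiv.symm.trans
                  (Equiv.prodCongr (ZMod.finEquiv L).toEquiv (ZMod.finEquiv M).toEquiv)) U δ /
                tubeStiffness L M (Fin (L * M))
                  (finProdFinEquiv.symm.trans
                    (Equiv.prodCongr (ZMod.finEquiv L).toEquiv (ZMod.finEquiv M).toEquiv)) U δ) / (M : ℝ))) ≤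
            tubeColumnPairCorr L M (Fin (L * M))
              (finProdFinEquiv.symm.trans
                (Equiv.prodCongr (ZMod.finEquiv L).toEquiv (ZMod.finEquiv M).toEquiv)) ψ r := by
  constructor
  · intro h L _ hLe hML hL ψ hψ hGS r hr hrL
    exact h L hLe hML hL (Fin (L * M)) _ ψ hψ hGS r hr hrL
  · intro h L _ _ hLe hML hL Λ _ _ e ψ hψ hGS r hr hrL
    set e₀ : Fin (L * M) ≃ ZMod L × ZMod M := finProdFinEquiv.symm.trans
      (Equiv.prodCongr (ZMod.finEquiv L).toEquiv (ZMod.finEquiv M).toEquiv) with he₀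
    have key := h L hLe hML hL (relabelVec (Orb.mapEquiv (e.trans e₀.symm)) ψ)
      (by rw [star_relabelVec_self, hψ]) (isGroundStateInSector_tubeH0_relabelVec L M Λ e _ e₀ U hGS)
      r hr hrL
    rwa [tubeColumnPairCorr_relabelVec, ← tubeStiffness_relabel L M Λ e _ e₀,
      ← tubePairCompressibility_relabel L M Λ e _ e₀] at key

end CanonicalLaw

end Summit.HubbardSuperconductivity.HubbardSuperconductivity.Theorems.WidthHaldane

end
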